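import Literature.NumberTheory.Sieve.QuadraticRootsPrimeModuliDFISieveIdentities
import HarnessLib

/-!
# Duke–Friedlander–Iwaniec 1995, §6: sifted sums in the quotient convention (Buchstab, Legendre reindexed)

Topic `Literature/NumberTheory/Sieve`.  Second layer towards the discharge of the named fact
`Literature.NumberTheory.Sieve.dukeFriedlanderIwaniec1995_theorem5` (DFI's Theorem 5, §6 of
W. Duke, J. B. Friedlander, H. Iwaniec, *Equidistribution of roots of a quadratic congruence to
prime moduli*, Ann. of Math. 141 (1995), pp. 433–437).

The paper's `C_d = {c_n : n ≡ 0 (mod d)}` is to be read as the sequence `m ↦ c_{dm}` (supported on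
`m ≤ x/d`), and `S(C_d, z) = ∑_{(m, P(z)) = 1} c_{dm}` sifts the QUOTIENT `m = n/d`, not `n`: only
with this reading is the term `S(C_{pq}, y_k)` of Lemma 1 (26) (with `p < y_k`) non-trivial and equal
to a general bilinear form (33).  The companion file `…DFISieveIdentities` proves Buchstab's and
Legendre's identities for `DFI1995.sifted c x z = ∑_{n ≤ x, (n,P(z))=1} c_n`; here they are
transported to

* `DFI1995.quotSeq c d = (m ↦ c (d m))`, `DFI1995.quotSum c x d = ∑_{1 ≤ m ≤ ⌊x⌋/d} c (d m)`
  (`= |C_d|`, literally the inner sum of `DFI1995.sieveR₁`),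
  `DFI1995.siftedQ c x d z = S(C_d, z) = ∑_{1 ≤ m ≤ ⌊x⌋/d, (m, P(z)) = 1} c (d m)`
  (`= sifted (quotSeq c d) (x/d) z`, `DFI1995.siftedQ_eq_sum_filter`);
* **Buchstab** in the quotient convention (`DFI1995.siftedQ_buchstab`):
  `S(C_d, z) = S(C_d, w) − ∑_{w ≤ p < z} S(C_{dp}, p)` for `w ≤ z`, from the reindexing
  `sifted (restrictSeq c p) X z = sifted (quotSeq c p) (X/p) z` when `(p, P(z)) = 1`
  (`DFI1995.sifted_restrictSeq_eq_sifted_quotSeq`); iterated: `DFI1995.siftedQ_buchstab_twice`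
  (first display of p. 434), and the exchange of the two prime variables
  (`DFI1995.sum_primesIco_sum_primesIco_comm`);
* **Legendre** in the quotient convention (`DFI1995.siftedQ_eq_sum_moebius`):
  `S(C_d, w) = ∑_{e ∣ P(w)} μ(e) |C_{de}|`.

All statements are finite identities valid for every sequence with values in an additive
commutative group; nothing here is specific to DFI's `ρ_h`.

## References

* W. Duke, J. B. Friedlander, H. Iwaniec, Ann. of Math. (2) 141 (1995), 423–441, §6 p. 434.
  [cite: DukeFriedlanderIwaniec1995, §6 p. 434]
-/

namespace Literature.NumberTheory.Sieve

open scoped BigOperators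
open Finset

namespace DFI1995

noncomputable section

variable {M : Type*}

/-! ### Prime ranges and small arithmetic helpers -/

/-- The primes `p` with `u ≤ p < v` (real endpoints), as a `Finset ℕ`; this is literally the index
set `(Nat.primesBelow ⌈v⌉₊).filter (u ≤ ·)` of `DFI1995.sifted_buchstab`. [folklore] -/
def primesIco (u v : ℝ) : Finset ℕ := (Nat.primesBelow ⌈v⌉₊).filter (fun p : ℕ => u ≤ (p : ℝ))

/-- Membership in `primesIco u v`. [folklore] -/
theorem mem_primesIco {u v : ℝ} {p : ℕ} :
    p ∈ primesIco u v ↔ p.Prime ∧ u ≤ (p : ℝ) ∧ (p : ℝ) < v := by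
  simp only [primesIco, Finset.mem_filter, Nat.mem_primesBelow, Nat.lt_ceil]
  tauto

/-- `primesIco u v ⊆ primesIco u' v'` when `u' ≤ u` and `v ≤ v'`. [folklore] -/
theorem primesIco_subset_primesIco {u v u' v' : ℝ} (hu : u' ≤ u) (hv : v ≤ v') :
    primesIco u v ⊆ primesIco u' v' := by
  intro p hp
  rw [mem_primesIco] at hp ⊢
  exact ⟨hp.1, hu.trans hp.2.1, hp.2.2.trans_le hv⟩

/-- A prime `p` is coprime to `P(z)` as soon as `z ≤ p`. [folklore] -/
theorem prime_coprime_primesProdBelow {p : ℕ} (hp : p.Prime) {z : ℝ} (hz : z ≤ (p : ℝ)) :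
    Nat.Coprime p (primesProdBelow z) := by
  rw [coprime_primesProdBelow_iff]
  intro q hq hqp
  rw [Nat.mem_primesBelow, Nat.lt_ceil] at hq
  have hqp' : q = p := (Nat.prime_dvd_prime_iff_eq hq.2 hp).1 hqp
  rw [hqp'] at hq
  exact absurd hq.1 (not_lt.2 hz)

/-! ### The objects in the quotient convention -/

/-- The quotient sequence `C_d`: `quotSeq c d = (m ↦ c (d m))`.
[cite: DukeFriedlanderIwaniec1995, §6 p. 434] -/
def quotSeq (c : ℕ → M) (d : ℕ) : ℕ → M := fun m => c (d * m)

/-- Unfolding `quotSeq`. [folklore] -/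
@[simp] theorem quotSeq_apply (c : ℕ → M) (d m : ℕ) : quotSeq c d m = c (d * m) := rfl

/-- `C_1 = C`. [folklore] -/
@[simp] theorem quotSeq_one (c : ℕ → M) : quotSeq c 1 = c := by
  funext m; simp [quotSeq]

/-- `(C_d)_e = C_{de}`. [folklore] -/
theorem quotSeq_quotSeq (c : ℕ → M) (d e : ℕ) : quotSeq (quotSeq c d) e = quotSeq c (d * e) := by
  funext m; simp [quotSeq, mul_assoc]

variable [AddCommGroup M]

/-- `|C_d| = ∑_{1 ≤ m ≤ ⌊x⌋/d} c (d m)` (`= ∑_{n ≤ x, d ∣ n} c_n`); this is the inner sum of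
`DFI1995.sieveR₁`. [cite: DukeFriedlanderIwaniec1995, §6 p. 434 and (32)] -/
def quotSum (c : ℕ → M) (x : ℝ) (d : ℕ) : M := ∑ m ∈ Icc 1 (⌊x⌋₊ / d), c (d * m)

/-- `S(C_d, z) = ∑_{1 ≤ m ≤ x/d, (m, P(z)) = 1} c (d m)`, the sifted sum of the quotient sequence
(`sifted (quotSeq c d) (x/d) z`). [cite: DukeFriedlanderIwaniec1995, §6 p. 434] -/
def siftedQ (c : ℕ → M) (x : ℝ) (d : ℕ) (z : ℝ) : M :=
  sifted (quotSeq c d) (x / d) z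

/-- `S(C_d, z)` written out: `∑_{1 ≤ m ≤ ⌊x⌋/d, (m, P(z)) = 1} c (d m)`. [folklore] -/
theorem siftedQ_eq_sum_filter (c : ℕ → M) (x : ℝ) (d : ℕ) (z : ℝ) :
    siftedQ c x d z =
      ∑ m ∈ (Icc 1 (⌊x⌋₊ / d)).filter (fun m : ℕ => m.Coprime (primesProdBelow z)), c (d * m) := by
  unfold siftedQ sifted
  have hI : Ioc 0 (⌊x⌋₊ / d) = Icc 1 (⌊x⌋₊ / d) := by
    ext m
    simp only [Finset.mem_Ioc, Finset.mem_Icc]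
    omega
  rw [Nat.floor_div_natCast, hI]
  rfl

/-- `S(C_1, z) = S(C, z)`. [folklore] -/
theorem siftedQ_one (c : ℕ → M) (x z : ℝ) : siftedQ c x 1 z = sifted c x z := by
  simp [siftedQ]

/-- `|(C_d)_e|` at level `x/d` is `|C_{de}|` at level `x`. [folklore] -/
theorem quotSum_quotSeq (c : ℕ → M) (x : ℝ) (d e : ℕ) :
    quotSum (quotSeq c d) (x / d) e = quotSum c x (d * e) := by
  unfold quotSum
  rw [Nat.floor_div_natCast, Nat.div_div_eq_div_mul]
  refine Finset.sum_congr rfl fun m _ => ?_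
  simp [mul_assoc]

/-- `S((C_d)_p, z)` at level `x/d/p` is `S(C_{dp}, z)` at level `x`. [folklore] -/
theorem sifted_quotSeq_quotSeq (c : ℕ → M) (x : ℝ) (d p : ℕ) (z : ℝ) :
    sifted (quotSeq (quotSeq c d) p) (x / d / p) z = siftedQ c x (d * p) z := by
  unfold siftedQ
  rw [quotSeq_quotSeq, Nat.cast_mul, div_div]

/-! ### Reindexing `n = p m` -/

/-- `∑_{n ≤ X, p ∣ n, (n, P(z)) = 1} c_n = ∑_{m ≤ X/p, (m, P(z)) = 1} c_{pm}` when `(p, P(z)) = 1`: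
the sifted sum of the restricted sequence is the sifted sum of the quotient sequence. [folklore] -/
theorem sifted_restrictSeq_eq_sifted_quotSeq (c : ℕ → M) (X : ℝ) {p : ℕ} (hp : 0 < p) {z : ℝ}
    (hpz : Nat.Coprime p (primesProdBelow z)) :
    sifted (restrictSeq c p) X z = sifted (quotSeq c p) (X / p) z := by
  unfold sifted
  simp only [restrictSeq_apply, quotSeq_apply]
  rw [← Finset.sum_filter, Nat.floor_div_natCast]
  symm
  refine Finset.sum_nbij' (fun m => p * m) (fun n => n / p) ?_ ?_ ?_ ?_ ?_
  · intro m hm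
    simp only [Finset.mem_filter, Finset.mem_Ioc] at hm ⊢
    obtain ⟨⟨hm0, hmle⟩, hcop⟩ := hm
    refine ⟨⟨⟨Nat.mul_pos hp hm0, ?_⟩, Nat.Coprime.mul_left hpz hcop⟩, dvd_mul_right p m⟩
    rw [mul_comm]; exact (Nat.le_div_iff_mul_le hp).1 hmle
  · intro n hn
    simp only [Finset.mem_filter, Finset.mem_Ioc] at hn ⊢
    obtain ⟨⟨⟨hn0, hnle⟩, hcop⟩, hpn⟩ := hn
    exact ⟨⟨Nat.div_pos (Nat.le_of_dvd hn0 hpn) hp, Nat.div_le_div_right hnle⟩,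
      Nat.Coprime.coprime_dvd_left (Nat.div_dvd_of_dvd hpn) hcop⟩
  · intro m _
    exact Nat.mul_div_cancel_left m hp
  · intro n hn
    simp only [Finset.mem_filter] at hn
    exact Nat.mul_div_cancel' hn.2
  · intro m _
    rfl

/-- `|C_d| = ∑_{n ≤ X, d ∣ n} c_n = ∑_{1 ≤ m ≤ ⌊X⌋/d} c_{dm}` (`multSum = quotSum`). [folklore] -/
theorem multSum_eq_quotSum (c : ℕ → M) (X : ℝ) (d : ℕ) : multSum c X d = quotSum c X d := by
  unfold multSum quotSum
  rcases Nat.eq_zero_or_pos d with rfl | hd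
  · rw [Nat.div_zero]
    have h1 : (Ioc 0 ⌊X⌋₊).filter (fun n : ℕ => 0 ∣ n) = ∅ := by
      ext n
      simp only [Finset.mem_filter, Finset.mem_Ioc, zero_dvd_iff, Finset.notMem_empty, iff_false]
      omega
    rw [h1]; simp
  symm
  refine Finset.sum_nbij' (fun m => d * m) (fun n => n / d) ?_ ?_ ?_ ?_ ?_
  · intro m hm
    simp only [Finset.mem_filter, Finset.mem_Ioc, Finset.mem_Icc] at hm ⊢
    refine ⟨⟨Nat.mul_pos hd (by omega), ?_⟩, dvd_mul_right d m⟩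
    rw [mul_comm]; exact (Nat.le_div_iff_mul_le hd).1 hm.2
  · intro n hn
    simp only [Finset.mem_filter, Finset.mem_Ioc, Finset.mem_Icc] at hn ⊢
    obtain ⟨⟨hn0, hnle⟩, hdn⟩ := hn
    exact ⟨Nat.div_pos (Nat.le_of_dvd hn0 hdn) hd, Nat.div_le_div_right hnle⟩
  · intro m _
    exact Nat.mul_div_cancel_left m hd
  · intro n hn
    simp only [Finset.mem_filter] at hn
    exact Nat.mul_div_cancel' hn.2
  · intro m _
    rfl

/-! ### Buchstab's identity in the quotient convention -/

/-- **Buchstab's identity for `S(C_d, ·)`** (quotient convention): for `w ≤ z`,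
`S(C_d, z) = S(C_d, w) − ∑_{w ≤ p < z} S(C_{dp}, p)`.
[cite: DukeFriedlanderIwaniec1995, §6 p. 434] -/
theorem siftedQ_buchstab (c : ℕ → M) (x : ℝ) (d : ℕ) {w z : ℝ} (hwz : w ≤ z) :
    siftedQ c x d z = siftedQ c x d w - ∑ p ∈ primesIco w z, siftedQ c x (d * p) p := by
  unfold siftedQ primesIco
  rw [sifted_buchstab (quotSeq c d) (x / d) hwz]
  congr 1
  refine Finset.sum_congr rfl fun p hp => ?_
  have hpp : p.Prime := (mem_primesIco.1 hp).1
  rw [sifted_restrictSeq_eq_sifted_quotSeq _ _ hpp.pos (prime_coprime_primesProdBelow hpp le_rfl),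
    quotSeq_quotSeq, Nat.cast_mul, div_div]

/-- **Buchstab twice** (first display of p. 434, quotient convention): for `w ≤ z`,
`S(C_d, z) = S(C_d, w) − ∑_{w ≤ p < z} S(C_{dp}, w) + ∑_{w ≤ p < z} ∑_{w ≤ q < p} S(C_{dpq}, q)`.
[cite: DukeFriedlanderIwaniec1995, §6 p. 434] -/
theorem siftedQ_buchstab_twice (c : ℕ → M) (x : ℝ) (d : ℕ) {w z : ℝ} (hwz : w ≤ z) :
    siftedQ c x d z = siftedQ c x d w - ∑ p ∈ primesIco w z, siftedQ c x (d * p) w +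
      ∑ p ∈ primesIco w z, ∑ q ∈ primesIco w p, siftedQ c x (d * p * q) q := by
  rw [siftedQ_buchstab c x d hwz, sub_add, ← Finset.sum_sub_distrib]
  congr 1
  refine Finset.sum_congr rfl fun p hp => ?_
  have hwp : w ≤ (p : ℝ) := (mem_primesIco.1 hp).2.1
  rw [siftedQ_buchstab c x (d * p) hwp]

/-- Exchanging the two prime variables of the double Buchstab sum:
`∑_{w ≤ p < z} ∑_{w ≤ q < p} F(p, q) = ∑_{w ≤ q < z} ∑_{w ≤ p < z, q < p} F(p, q)`. [folklore] -/
theorem sum_primesIco_sum_primesIco_comm {N : Type*} [AddCommMonoid N] (w z : ℝ) (F : ℕ → ℕ → N) :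
    ∑ p ∈ primesIco w z, ∑ q ∈ primesIco w p, F p q =
      ∑ q ∈ primesIco w z, ∑ p ∈ (primesIco w z).filter (fun p : ℕ => q < p), F p q := by
  refine Finset.sum_comm' fun p q => ?_
  simp only [Finset.mem_filter, mem_primesIco, Nat.cast_lt]
  constructor
  · rintro ⟨⟨hp, hwp, hpz⟩, hq, hwq, hqp⟩
    exact ⟨⟨⟨hp, hwp, hpz⟩, hqp⟩, hq, hwq, lt_trans (by exact_mod_cast hqp) hpz⟩
  · rintro ⟨⟨⟨hp, hwp, hpz⟩, hqp⟩, hq, hwq, -⟩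
    exact ⟨⟨hp, hwp, hpz⟩, hq, hwq, hqp⟩

/-! ### Legendre's identity in the quotient convention -/

/-- **Legendre's identity for `S(C_d, w)`** (quotient convention):
`S(C_d, w) = ∑_{e ∣ P(w)} μ(e) |C_{de}|`. [cite: DukeFriedlanderIwaniec1995, §6 p. 434] -/
theorem siftedQ_eq_sum_moebius (c : ℕ → M) (x : ℝ) (d : ℕ) (w : ℝ) :
    siftedQ c x d w =
      ∑ e ∈ (primesProdBelow w).divisors, (ArithmeticFunction.moebius e) • quotSum c x (d * e) := by
  unfold siftedQ
  rw [sifted_eq_sum_moebius]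
  refine Finset.sum_congr rfl fun e _ => ?_
  rw [multSum_eq_quotSum, quotSum_quotSeq]

end

end DFI1995

end Literature.NumberTheory.Sieve
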